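import Mathlib
import Literature.MeasureTheory.Moments.TruncatedMomentProblem
import HarnessLib

/-!
# Strictly positive Riesz functionals have representing measures (Fialkow–Nie 2010, Thm 1.3)

**DEPRECATED DUPLICATE (librarian refactor wi-26178, 2026-08-15).** The same theorem was vendored
four times on 2026-08-15 by parallel seats; the survivor is
`Literature.MeasureTheory.Moments.FialkowNie2010_thm13`
(`MeasureTheory/Moments/TruncatedMomentProblem`, DISCHARGED by `…TruncatedMomentProblemProofs`).
This file keeps its declaration (never deleted) as a deprecated `def`, statement byte-identical;
its discharge from the survivor's `FialkowNie2010_thm13_holds` (a reordering of binders, with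
`Finsupp.degree α = α.sum fun _ e ↦ e`) follows in a second step of wi-26178 once
`…TruncatedMomentProblemProofs` is built on the farm. New users should import the survivor.

L. Fialkow, J. Nie, *Positivity of Riesz functionals and solutions of quadratic and quartic moment
problems*, J. Funct. Anal. **258** (2010) 328–356 (arXiv:0908.3230), §1, Theorem 1.3.

Setting (§1, p. 2 of the arXiv version). A *truncated moment sequence* of degree `k` in `n`
variables is a real multisequence `y = (y_α)_{α ∈ ℤ₊ⁿ, |α| ≤ k}`; a *`K`-representing measure*
(`K ⊆ ℝⁿ` closed) is a positive Borel measure `μ` on `ℝⁿ`, supported in `K`, with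
`y_α = ∫ x^α dμ` for all `|α| ≤ k`. The *Riesz functional* `L_y : 𝒫_k → ℝ` is
`L_y(p) = Σ_{|α| ≤ k} p_α y_α`. `L_y` is *`K`-positive* if `L_y(p) ≥ 0` whenever `p ∈ 𝒫_k`,
`p|_K ≥ 0`, and *strictly `K`-positive* if moreover `L_y(p) > 0` whenever `p|_K ≥ 0` and
`p|_K ≢ 0`. `K` is a *determining set (of degree `k`)* if `p ∈ 𝒫_k`, `p|_K ≡ 0` imply `p ≡ 0`
("sets `K` with nonempty interior are clearly determining").

**Theorem 1.3.** "Suppose `K` is a determining set of degree `k` and let `y` be a truncated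
moment sequence of degree `k` in `n` variables. If `L_y` is strictly `K`-positive, then `y` admits
a `K`-representing measure."

(For compact `K`, `K`-positivity already suffices — Tchakaloff; in general it does not, ibid.
For `K = ℝⁿ` and ODD `k = 2d + 1` a polynomial of degree `≤ k` that is non-negative on `ℝⁿ` has
degree `≤ 2d`, so strict positivity is a condition on the even part only; for `k = 3` it says
`L_y(q) > 0` for every non-zero non-negative quadratic `q`, i.e. the moment matrix `M₁(y)` is
positive definite — this is the form used by route `MomentParity` of `AnomalousDissipation`,
crux `Summit.AnomalousDissipation.AnomalousDissipation.Theses.MomentParity.CubicParityLoud`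
("odd-order realizability is vacuous once the covariance is definite").)

Vendored AS PRINTED as a named fact (a `def … : Prop`, review-queued, no proof; users take
`(h : FialkowNie2010_thm13)`). Typing: multi-indices are `Fin n →₀ ℕ` with `|α| = α.degree`,
polynomials are `MvPolynomial (Fin n) ℝ` with `totalDegree ≤ k`, the Riesz functional is written
out as `Σ_{α ∈ p.support} coeff_α(p) · y_α`, "positive Borel measure on `ℝⁿ` supported in `K`" is a
`Measure (Fin n → ℝ)` (Borel σ-algebra) with `μ Kᶜ = 0`, and "`y_α = ∫ x^α dμ`" carries the
integrability of the monomial explicitly. `p|_K ≢ 0` is `∃ x ∈ K, eval x p ≠ 0`. Values `y α` with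
`|α| > k` are never used.
-/

namespace Literature.Analysis.Moments

open _root_.MeasureTheory

/-- **Fialkow–Nie 2010, Theorem 1.3.** Let `K ⊆ ℝⁿ` be closed and determining of degree `k`
(a polynomial of degree `≤ k` vanishing on `K` is zero) and let `y` be a truncated moment sequence
of degree `k` in `n` variables whose Riesz functional `L_y(p) = Σ_{|α|≤k} p_α y_α` is strictly
`K`-positive (`L_y(p) ≥ 0` for `p ∈ 𝒫_k` with `p|_K ≥ 0`, and `L_y(p) > 0` if moreover
`p|_K ≢ 0`). Then `y` admits a `K`-representing measure: a positive Borel measure `μ` on `ℝⁿ`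
supported in `K` with `y_α = ∫ x^α dμ` for all `|α| ≤ k`. Grounds the parity lemma of
`Summit.AnomalousDissipation.AnomalousDissipation.Theses.MomentParity.CubicParityLoud`
(`K = ℝⁿ`, `k = 3`: every degree-3 truncated moment sequence with positive definite `M₁(y)` is
realised by a measure). [cite: FialkowNie2010, Thm 1.3] -/
@[deprecated Literature.MeasureTheory.Moments.FialkowNie2010_thm13 (since := "2026-08-15")]
def FialkowNie2010_thm13 : Prop :=
  ∀ (n k : ℕ) (K : Set (Fin n → ℝ)) (y : (Fin n →₀ ℕ) → ℝ),
    IsClosed K →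
    -- `K` is a determining set of degree `k`
    (∀ p : MvPolynomial (Fin n) ℝ, p.totalDegree ≤ k →
        (∀ x ∈ K, MvPolynomial.eval x p = 0) → p = 0) →
    -- `L_y` is `K`-positive …
    (∀ p : MvPolynomial (Fin n) ℝ, p.totalDegree ≤ k →
        (∀ x ∈ K, 0 ≤ MvPolynomial.eval x p) →
        0 ≤ ∑ α ∈ p.support, p.coeff α * y α) →
    -- … and strictly `K`-positive
    (∀ p : MvPolynomial (Fin n) ℝ, p.totalDegree ≤ k →
        (∀ x ∈ K, 0 ≤ MvPolynomial.eval x p) → (∃ x ∈ K, MvPolynomial.eval x p ≠ 0) →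
        0 < ∑ α ∈ p.support, p.coeff α * y α) →
    ∃ μ : Measure (Fin n → ℝ), μ Kᶜ = 0 ∧
      ∀ α : Fin n →₀ ℕ, α.degree ≤ k →
        Integrable (fun x : Fin n → ℝ => ∏ i, x i ^ α i) μ ∧
          ∫ x, (∏ i, x i ^ α i) ∂μ = y α

end Literature.Analysis.Moments
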